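import Literature.AlgebraicGeometry.Motives.AbelianVarietyDegree
import Literature.AlgebraicGeometry.Motives.SecOfForm
import Literature.AlgebraicGeometry.Motives.FormsOnSections
import Literature.AlgebraicGeometry.Motives.ProjectiveNoetherNormalization
import Literature.AlgebraicGeometry.Motives.ProjectiveDescentSections
import HarnessLib

/-!
# Forms on a projective embedding: `X_{F(s)} = r⁻¹ D₊(F)` for the hyperplane divisor of `r : X ↪ ℙ^N`

Topic: `Literature/AlgebraicGeometry/Resolution`. Bookkeeping for the choice of the projection
`π = (t₀ : … : t_{d+1})`, `t_j = F_j(s)`, in de Jong's proof of Lemma 4.11 (de Jong 1996,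
p. 68: "we choose an embedding `X ↪ ℙ^N` …"; the leaf `DeJong1996Lemma411VertexChoice`,
route of `Lemma411FormsProjection.lean`). The projection of `Lemma411FormsProjection` is
built from a Cartier divisor `E` with global sections `s₀, …, s_N` (the tree's
`CartierDivisor.toGeneratingSections`), whereas the chart calculus of forms — chart values
`F(s)/xᵢᵉ = r^*(F/xᵢᵉ)` (`GeneratingSections.sectionsFun`, `Motives/SecOfForm`,
`Resolution/FormsOnAffineCharts`) — lives on the generating sections
`GeneratingSections.ofHom r` of a morphism `r : X → ℙ^N`. This file identifies the two for
the HYPERPLANE DIVISOR `H = div(r^* x_{j₀})` of a morphism `r : X → ℙ^N_k` from an integral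
`k`-scheme (`GeneratingSections.divisor`, `Motives/AbelianVarietyDegree`) and its coordinate
sections `s_a = r^*(x_a/x_{j₀}) ∈ Γ(X, 𝒪_X(H))` (`GeneratingSections.ratioFn`; some of them may
vanish identically, which `CartierDivisor.toGeneratingSections` does not allow but nothing here
needs):

* `embDivisor r j₀ hj₀`, `embSections r j₀ hj₀ a` — `H` and the `s_a`;
  `isSection_embSections`;
* `toFunctionField_germ_sectionsFun` — the rational function of the chart value
  `(ofHom r).sectionsFun f i F` is `F(s₀/sᵢ, …, s_N/sᵢ)`;
* **`mem_nonvanishing_aeval_embSections_iff`** — for a form `F` of degree `e ≥ 1` and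
  `x ∈ r⁻¹D₊(xᵢ)`: `x ∈ X_{F(s)}` (non-vanishing locus of the section `F(s)` of `𝒪_X(e H)`) iff
  `x ∈ X_{F(s)/xᵢᵉ}` (basic open of the chart value) iff `r(x) ∈ D₊(F)`; hence
  **`nonvanishingOpens_aeval_embSections_eq` : `X_{F(s)} = r⁻¹ D₊(F)`**, affine when `r` is
  affine (`isAffineOpen_nonvanishingOpens_aeval_embSections`), and membership at a point of an
  affine chart read on the prime ideal of the point
  (`mem_nonvanishing_aeval_embSections_iff_notMem_primeIdealOf`).

Everything is [folklore] (Görtz–Wedhorn I, (13.11): `r⁻¹(D₊(f)) = X_f`) and PROVED; no named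
fact.

## Sources

* U. Görtz, T. Wedhorn, *Algebraic Geometry I: Schemes*, 2nd ed. (2020), (13.11) p. 495,
  Remark 13.46. [GortzWedhorn2020]
* A. J. de Jong, *Smoothness, semi-stability and alterations*, Publ. Math. IHÉS 83 (1996),
  proof of Lemma 4.11, p. 68. [DeJong1996]
-/

noncomputable section

open CategoryTheory CategoryTheory.Limits AlgebraicGeometry TopologicalSpace HomogeneousLocalization
open MvPolynomial (aeval eval₂ C)

attribute [local instance] MvPolynomial.gradedAlgebra

namespace Literature.AlgebraicGeometry.Resolution

universe u

open Literature.AlgebraicGeometry.Motives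
open Literature.AlgebraicGeometry.Motives.Segre (grading chartι toSpec X_mem)
open Literature.AlgebraicGeometry.Motives.RatFn
open Literature.AlgebraicGeometry.Motives.GeneratingSections (ofHom preU)

section Embedding

variable {k : Type u} [Field k] {X : Scheme.{u}} [IsIntegral X] [X.Over (Spec (.of k))] {N : ℕ}
  (r : X ⟶ Proj (grading (Fin (N + 1)) k)) (j₀ : Fin (N + 1))
  (hj₀ : genericPoint X ∈ (ofHom r).U j₀)

/-- **The hyperplane divisor `H = div(r^* x_{j₀})`** of `r : X → ℙ^N` (`X` integral,
`r⁻¹D₊(x_{j₀}) ≠ ∅`). [folklore] -/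
abbrev embDivisor : CartierDivisor X := (ofHom r).divisor j₀ hj₀

/-- **The coordinate sections `s_a = r^*(x_a/x_{j₀}) ∈ Γ(X, 𝒪_X(H))`**, as rational functions
(zero when `X ⊆ V₊(x_a)`). [folklore] -/
abbrev embSections (a : Fin (N + 1)) : X.functionField := (ofHom r).ratioFn j₀ a hj₀

omit [X.Over (Spec (.of k))] in
/-- The `s_a` are global sections of `𝒪_X(H)`. [folklore] -/
theorem isSection_embSections (a : Fin (N + 1)) : (embDivisor r j₀ hj₀).IsSection (embSections r j₀ hj₀ a) :=
  (ofHom r).isSection_divisor_ratioFn j₀ hj₀ a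

/-- `F(s) ∈ Γ(X, 𝒪_X(e H))` for a form `F` of degree `e`. [folklore] -/
theorem isSection_aeval_embSections {e : ℕ} {F : MvPolynomial (Fin (N + 1)) k}
    (hF : F ∈ grading (Fin (N + 1)) k e) :
    (e • embDivisor r j₀ hj₀).IsSection (aeval (embSections r j₀ hj₀) F) :=
  CartierDivisor.isSection_aeval (isSection_embSections r j₀ hj₀)
    ((MvPolynomial.mem_homogeneousSubmodule _ _).1 hF)

/-- **The rational function of the chart value `F(s)/xᵢᵉ`**: for `x ∈ r⁻¹D₊(xᵢ)`, the germ at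
`x` of `(ofHom r).sectionsFun f i F ∈ Γ(X, r⁻¹D₊(xᵢ))`, read in `K(X)`, is
`F(…, r^*(x_a/xᵢ), …)`. [folklore] -/
theorem toFunctionField_germ_sectionsFun (i : Fin (N + 1)) {x : X} (hx : x ∈ (ofHom r).U i)
    (F : MvPolynomial (Fin (N + 1)) k) :
    toFunctionField x (X.presheaf.germ ((ofHom r).U i) x hx ((ofHom r).sectionsFun (X ↘ Spec (.of k)) i F)) =
      eval₂ (algebraMap k X.functionField)
        (fun a => (ofHom r).ratioFn i a ((ofHom r).genericPoint_mem_U hx)) F := by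
  -- both sides are ring maps `k[x] → K(X)`; compare on constants and variables
  let φ : MvPolynomial (Fin (N + 1)) k →+* X.functionField :=
    ((toFunctionField x).comp (X.presheaf.germ ((ofHom r).U i) x hx).hom).comp
      ((ofHom r).sectionsFun (X ↘ Spec (.of k)) i)
  change φ F = MvPolynomial.eval₂Hom _ _ F
  congr 1
  refine MvPolynomial.ringHom_ext (fun c => ?_) (fun a => ?_)
  · simp only [φ, RingHom.comp_apply, GeneratingSections.sectionsFun_C, MvPolynomial.coe_eval₂Hom,
      MvPolynomial.eval₂_C]
    change toFunctionField x ((X.presheaf.germ ((ofHom r).U i) x hx)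
      ((X.presheaf.map (homOfLE le_top).op) (Segre.pull (X ↘ Spec (.of k)) c))) = _
    rw [TopCat.Presheaf.germ_res_apply, Segre.pull_apply, ← algebraMap_stalk_apply,
      ← IsScalarTower.algebraMap_apply]
  · simp only [φ, RingHom.comp_apply, GeneratingSections.sectionsFun_X, MvPolynomial.coe_eval₂Hom,
      MvPolynomial.eval₂_X]
    exact ((ofHom r).ratioFn_eq_toFunctionField a hx).symm

/-- **`x ∈ X_{F(s)}` iff `x ∈ X_{F(s)/xᵢᵉ}`** for `x ∈ r⁻¹D₊(xᵢ)` and a form `F` of degree `e`: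
the section `F(s)` of `𝒪_X(eH)` generates at `x` iff its chart value, the regular function
`F(s)/xᵢᵉ = F(…, x_a/xᵢ, …)` on `r⁻¹D₊(xᵢ)`, is a unit at `x` (the local equation of `eH` on
`r⁻¹D₊(xᵢ)` being `(x_{j₀}/xᵢ)ᵉ`, and `F(s) (x_{j₀}/xᵢ)ᵉ = F(…, x_a/xᵢ, …)` by homogeneity).
[cite: GortzWedhorn2020, (13.11) p. 495] -/
theorem mem_nonvanishing_aeval_embSections_iff_mem_basicOpen {e : ℕ}
    {F : MvPolynomial (Fin (N + 1)) k} (hF : F ∈ grading (Fin (N + 1)) k e)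
    (i : Fin (N + 1)) {x : X} (hx : x ∈ (ofHom r).U i) :
    x ∈ (e • embDivisor r j₀ hj₀).nonvanishing (aeval (embSections r j₀ hj₀) F) ↔
      x ∈ X.basicOpen ((ofHom r).sectionsFun (X ↘ Spec (.of k)) i F) := by
  have hξi : genericPoint X ∈ (ofHom r).U i := (ofHom r).genericPoint_mem_U hx
  -- the chart `i` of `H`
  let î : (embDivisor r j₀ hj₀).ι := ⟨⟨i, hξi⟩⟩
  have hxî : x ∈ (e • embDivisor r j₀ hj₀).U î := hx
  rw [CartierDivisor.mem_nonvanishing_iff (hi := hxî), CartierDivisor.smul_f]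
  change IsUnitAt x ((ofHom r).ratioFn i j₀ hξi ^ e * aeval (embSections r j₀ hj₀) F) ↔ _
  -- `(x_{j₀}/xᵢ)ᵉ F(x_a/x_{j₀}) = F(x_a/xᵢ)`
  have hval : (ofHom r).ratioFn i j₀ hξi ^ e * aeval (embSections r j₀ hj₀) F =
      eval₂ (algebraMap k X.functionField) (fun a => (ofHom r).ratioFn i a hξi) F := by
    have h1 : (fun a => (ofHom r).ratioFn i a hξi) =
        fun a => (ofHom r).ratioFn i j₀ hξi * embSections r j₀ hj₀ a := by
      funext a
      exact ((ofHom r).ratioFn_mul_ratioFn i j₀ a hξi hj₀).symm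
    rw [h1, Segre.eval₂_mul_left_of_isHomogeneous _ _ _
      ((MvPolynomial.mem_homogeneousSubmodule e F).1 hF)]
    rfl
  rw [hval, ← toFunctionField_germ_sectionsFun r i hx F, isUnitAt_germ_iff]

/-- **`x ∈ X_{F(s)}` iff `r(x) ∈ D₊(F)`** for a form `F` of degree `e ≥ 1`, `r` a morphism over
`k` (Görtz–Wedhorn I, (13.11): `r⁻¹(D₊(f)) = X_f`). [cite: GortzWedhorn2020, (13.11) p. 495] -/
theorem mem_nonvanishing_aeval_embSections_iff (hr : r ≫ toSpec (Fin (N + 1)) k = X ↘ Spec (.of k))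
    {e : ℕ} (he : 0 < e) {F : MvPolynomial (Fin (N + 1)) k} (hF : F ∈ grading (Fin (N + 1)) k e)
    (x : X) :
    x ∈ (e • embDivisor r j₀ hj₀).nonvanishing (aeval (embSections r j₀ hj₀) F) ↔
      r x ∈ Proj.basicOpen (grading (Fin (N + 1)) k) F := by
  obtain ⟨i, hx⟩ := (ofHom r).exists_mem_U x
  rw [mem_nonvanishing_aeval_embSections_iff_mem_basicOpen r j₀ hj₀ hF i hx,
    GeneratingSections.basicOpen_sectionsFun_ofHom (X ↘ Spec (.of k)) r hr i he F (by simpa using hF)]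
  exact ⟨fun h => h.2, fun h => ⟨hx, h⟩⟩

/-- **`X_{F(s)} = r⁻¹ D₊(F)`** as opens, for a form `F` of degree `e ≥ 1`.
[cite: GortzWedhorn2020, (13.11) p. 495] -/
theorem nonvanishingOpens_aeval_embSections_eq (hr : r ≫ toSpec (Fin (N + 1)) k = X ↘ Spec (.of k))
    {e : ℕ} (he : 0 < e) {F : MvPolynomial (Fin (N + 1)) k} (hF : F ∈ grading (Fin (N + 1)) k e) :
    (e • embDivisor r j₀ hj₀).nonvanishingOpens (aeval (embSections r j₀ hj₀) F) =
      r ⁻¹ᵁ Proj.basicOpen (grading (Fin (N + 1)) k) F :=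
  Opens.ext (Set.ext fun x => mem_nonvanishing_aeval_embSections_iff r j₀ hj₀ hr he hF x)

/-- **`X_{F(s)}` is affine** when `r` is an affine morphism (e.g. a closed immersion) and
`deg F ≥ 1`. [folklore] -/
theorem isAffineOpen_nonvanishingOpens_aeval_embSections [IsAffineHom r]
    (hr : r ≫ toSpec (Fin (N + 1)) k = X ↘ Spec (.of k))
    {e : ℕ} (he : 0 < e) {F : MvPolynomial (Fin (N + 1)) k} (hF : F ∈ grading (Fin (N + 1)) k e) :
    IsAffineOpen ((e • embDivisor r j₀ hj₀).nonvanishingOpens (aeval (embSections r j₀ hj₀) F)) := by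
  rw [nonvanishingOpens_aeval_embSections_eq r j₀ hj₀ hr he hF]
  exact (Proj.isAffineOpen_basicOpen _ F hF he).preimage r

/-- **Membership in `X_{F(s)}` read on the prime ideal of the point**: for an affine chart
`r⁻¹D₊(xᵢ) ∋ x` (e.g. `r` affine), `x ∈ X_{F(s)}` iff the chart value `F(s)/xᵢᵉ` does not lie
in the prime ideal of `x` in `Γ(X, r⁻¹D₊(xᵢ))`. [folklore] -/
theorem mem_nonvanishing_aeval_embSections_iff_notMem_primeIdealOf {e : ℕ}
    {F : MvPolynomial (Fin (N + 1)) k} (hF : F ∈ grading (Fin (N + 1)) k e)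
    {i : Fin (N + 1)} (hU : IsAffineOpen ((ofHom r).U i)) {x : X} (hx : x ∈ (ofHom r).U i) :
    x ∈ (e • embDivisor r j₀ hj₀).nonvanishing (aeval (embSections r j₀ hj₀) F) ↔
      (ofHom r).sectionsFun (X ↘ Spec (.of k)) i F ∉ (hU.primeIdealOf ⟨x, hx⟩).asIdeal := by
  rw [mem_nonvanishing_aeval_embSections_iff_mem_basicOpen r j₀ hj₀ hF i hx]
  exact GeneratingSections.mem_basicOpen_iff_notMem_primeIdealOf hU _ ⟨x, hx⟩

end Embedding

end Literature.AlgebraicGeometry.Resolution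

end
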